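import Summits.KontsevichZagierPeriods.KontsevichZagierPeriods.Theorems.HermiteRigidityEllipticMomentKernelStubSigmaRep

/-!
# `EllipticMomentKernel` (stmt-KontsevichZagierPeriods-10631), line `merge-first-single-hermite`:
# stub `stub_numeratorValue`

VALUE BOOKKEEPING OF THE CARRIER AFTER HERMITE. For a rational Weierstrass cubic
`f = cubic q₂ q₃ = 4x³ − q₂x − q₃` with `disc > 0` (bounded oval `σ = oval q₂ q₃ = (e₃, e₂)`),
a carrier representation `s = [σ, A(x) + B(x)/√f(x)]` whose numerator has been Hermite-reduced,
`B = α + βX + E` with `∫_σ E/√f = 0` (the exact part, a HYPOTHESIS here), has value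

  `value s = ∫_σ A + α·J₀ + β·J₁`,   `J₀ = ∫_σ dx/√f`, `J₁ = ∫_σ x dx/√f`.

This is pure linearity of the Bochner integral on `σ`: every summand is integrable on `σ`
(`A` by `sigmaRep_integrableOn_aeval`, `1/√f` and `x/√f` by `integrableOn_genIntegrandQ_oval`,
`E/√f` by `sigmaRep_integrableOn_aeval_div_sqrt`), and `J₀`, `J₁` are literally the two set
integrals that appear.
-/

noncomputable section

open MeasureTheory Set
open scoped Polynomial

namespace Summit.KontsevichZagierPeriods.HermiteRigidity.EllipticMomentKernel

open Literature.NumberTheory.Transcendental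
open Literature.NumberTheory.Transcendental.KZ
open Summit.KontsevichZagierPeriods.HermiteRigidity.EllipticMomentKernelNegative
open Summit.KontsevichZagierPeriods.KontsevichZagierPeriods.Theses.HermiteRigidity
  (EllipticMomentKernel HermiteExactFormVanishes)

/-- `σ = oval q₂ q₃` is Lebesgue measurable (it is `ℚ`-semialgebraic). [folklore] -/
theorem numeratorValue_measurableSet_oval {q₂ q₃ : ℚ} (hΔ : 0 < disc q₂ q₃) :
    MeasurableSet (oval q₂ q₃) :=
  (isSemialgebraic_oval hΔ).measurableSet_holds

/-- The integrand of `J₀`, `p ↦ 1/√f(p 0)`, is integrable on `σ` (case `m = 0` of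
`integrableOn_genIntegrandQ_oval`). [folklore] -/
theorem numeratorValue_integrableOn_J0 {q₂ q₃ : ℚ} (hΔ : 0 < disc q₂ q₃) :
    IntegrableOn (fun p : Fin 1 → ℝ => 1 / Real.sqrt (cubic q₂ q₃ (p 0))) (oval q₂ q₃) :=
  (integrableOn_genIntegrandQ_oval hΔ 0).congr_fun (fun p _ => by simp only [pow_zero])
    (numeratorValue_measurableSet_oval hΔ)

/-- The integrand of `J₁`, `p ↦ p 0/√f(p 0)`, is integrable on `σ` (case `m = 1` of
`integrableOn_genIntegrandQ_oval`). [folklore] -/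
theorem numeratorValue_integrableOn_J1 {q₂ q₃ : ℚ} (hΔ : 0 < disc q₂ q₃) :
    IntegrableOn (fun p : Fin 1 → ℝ => p 0 / Real.sqrt (cubic q₂ q₃ (p 0))) (oval q₂ q₃) :=
  (integrableOn_genIntegrandQ_oval hΔ 1).congr_fun (fun p _ => by simp only [pow_one])
    (numeratorValue_measurableSet_oval hΔ)

/-- **Stub `stub_numeratorValue`**: value bookkeeping of the carrier after Hermite. If the
numerator is `α + βX + E` with `∫_σ E/√f = 0` (the exact part), the value of `[σ, A + B/√f]` is
`∫_σ A + αJ₀ + βJ₁` — linearity of the Bochner integral, every piece being integrable on `σ`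
(`A` bounded, `x^m/√f ∈ L¹(σ)` by `integrableOn_genIntegrandQ_oval`).
[cite: KontsevichZagier2001, §1.1] -/
theorem stub_numeratorValue (q₂ q₃ : ℚ) (hΔ : 0 < disc q₂ q₃) (A E : ℚ[X]) (α β : ℚ)
    (hE : (∫ p in oval q₂ q₃, (Polynomial.aeval (p 0) E : ℝ) / Real.sqrt (cubic q₂ q₃ (p 0))) = 0)
    (s : IntegralRep 1) (hs : s.domain = oval q₂ q₃)
    (hsi : EqOn s.integrand (fun p => (Polynomial.aeval (p 0) A : ℝ) +
      (Polynomial.aeval (p 0) (Polynomial.C α + Polynomial.C β * Polynomial.X + E) : ℝ) /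
        Real.sqrt (cubic q₂ q₃ (p 0))) (oval q₂ q₃)) :
    s.value = (∫ p in oval q₂ q₃, (Polynomial.aeval (p 0) A : ℝ)) +
      (α : ℝ) * J0 q₂ q₃ + (β : ℝ) * J1 q₂ q₃ := by
  have hmeas : MeasurableSet (oval q₂ q₃) := numeratorValue_measurableSet_oval hΔ
  -- integrability on `σ` of the four summands
  have hA := sigmaRep_integrableOn_aeval hΔ A
  have h0 : IntegrableOn (fun p : Fin 1 → ℝ => (α : ℝ) * (1 / Real.sqrt (cubic q₂ q₃ (p 0))))
      (oval q₂ q₃) := (numeratorValue_integrableOn_J0 hΔ).const_mul _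
  have h1 : IntegrableOn (fun p : Fin 1 → ℝ => (β : ℝ) * (p 0 / Real.sqrt (cubic q₂ q₃ (p 0))))
      (oval q₂ q₃) := (numeratorValue_integrableOn_J1 hΔ).const_mul _
  have hEi := sigmaRep_integrableOn_aeval_div_sqrt hΔ E
  -- pointwise expansion of the integrand on `σ`
  have hexp : EqOn s.integrand (fun p => (Polynomial.aeval (p 0) A : ℝ) +
      (α : ℝ) * (1 / Real.sqrt (cubic q₂ q₃ (p 0))) +
      (β : ℝ) * (p 0 / Real.sqrt (cubic q₂ q₃ (p 0))) +
      (Polynomial.aeval (p 0) E : ℝ) / Real.sqrt (cubic q₂ q₃ (p 0))) (oval q₂ q₃) := by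
    intro p hp
    rw [hsi hp]
    simp only [map_add, map_mul, Polynomial.aeval_C, Polynomial.aeval_X, eq_ratCast]
    ring
  rw [IntegralRep.value, hs, setIntegral_congr_fun hmeas hexp, integral_add _ hEi,
    integral_add _ h1, integral_add hA h0, integral_const_mul, integral_const_mul, hE, add_zero]
  · rfl
  · exact hA.add h0
  · exact (hA.add h0).add h1

end Summit.KontsevichZagierPeriods.HermiteRigidity.EllipticMomentKernel
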